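import Mathlib
import Literature.MathematicalPhysics.QuantumFieldTheory.Balaban1983to89.B5Ineq167L2Zd

/-!
# [B5] (1.65) p.29 — the scalar operator `H_k` on SQUARE-SUMMABLE coarse data on `ℤ^d`:
# `ℓ²`-boundedness, `Q_kH_kB = B`, the identity (1.65) `⟨B, Δ_kB⟩ = ⟨∂H_kB, ∂H_kB⟩`, minimality,
# and the weak Euler–Lagrange characterisation — without a finite-support hypothesis

[B5] = T. Bałaban, *Propagators and renormalization transformations for lattice gauge theories. I*, Commun.
Math. Phys. **95** (1984) 17–40 [`Balaban1984PropagatorsI`].  PRINTED TEXT, p. 29 [PDF 13] (TEXT LOCATIONS ONLY —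
nothing printed enters as a hypothesis; quotations checked against the page render read as an image):
«Using (1.60), or better (1.63), we can verify all the properties of H_kB: Q_kH_kB = B, R∂*H_kB = 0, H_kB is a
minimum of ½⟨∂A, ∂A⟩ on the hyperplane {A : Q_kA = B, R∂*A = 0}, which means that ⟨∂A′, ∂H_kB⟩ = 0 on the subspace
{A′ : Q_kA′ = 0, R∂*A′ = 0}.», «The action Δ_k is thus defined by ⟨B, Δ_kB⟩ = ⟨∂H_kB, ∂H_kB⟩. (1.65)», and, on the
representation of `H_k` announced there, «It will be expressed in terms of well-defined bounded operators.».

WHAT THIS FILE ADDS (scalar analogue, whole lattice `ℤ^d`, every mesh `n+1`, every `a > 0`).  The tree has the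
scalar `H` only on FINITELY SUPPORTED coarse data (`B5Hk103Minimizer.HB n a T B = Σ_{y∈T} B(y)H(·,y)`: block
identity, minimality, (1.65) as `energy_HB_eq`, weak Euler–Lagrange uniqueness), while the action form and (1.67)
are available for all of `ℓ²(ℤ^d)` (`B5Ineq167L2Zd`, node 1 of this unit).  Here the operator side is extended to
ALL SQUARE-SUMMABLE coarse data `B ∈ ℓ²(ℤ^d)`:
* §1 a generic **Schur test for series kernels** (weighted Cauchy–Schwarz + Fubini for non-negative families):
  row sums `≤ R`, column sums `≤ C` ⇒ `Σ_p (Σ_y M(p,y)|f(y)|)² ≤ R·C·Σ_y f(y)²`;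
* §2 `HBZd n a B p := Σ'_y B(y)·H(p,y)` converges absolutely, agrees with `HB` on finitely supported data, satisfies
  the block identity `Σ_{p∈B(y'')} (H B)(p) = (n+1)^d·B(y'')` («Q_kH_kB = B», scalar, in the tree's un-normalised
  `Q'`), and is square-summable on the fine lattice with an explicit (mesh-dependent) bound — `H` is a bounded
  operator `ℓ²(ℤ^d) → ℓ²(ℤ^d_fine)`;
* §3 the scalar action operator `Δ^{scalar}B = κ ∗ B` maps `ℓ²` to `ℓ²` with `‖Δ^{scalar}B‖₂ ≤ ‖κ‖₁‖B‖₂`;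
* §4 `(−Δ^η)(H B) = (n+1)^{-2}·(Δ^{scalar}B)∘blk` and **(1.65) on `ℓ²`**:
  `energy (H B) = (n+1)^d/(n+1)² · ⟨B, Δ^{scalar}B⟩_{ℤ^d}` (`= … · actionFormZd n a B`), hence (1.67) in the (1.65)
  dress `(n+1)^{d-2}⟨∂₁B,∂₁B⟩ ≤ ⟨∂HB,∂HB⟩ ≤ (n+1)^{d-2}(π²/4)^{d+1}⟨∂₁B,∂₁B⟩` for every `B ∈ ℓ²(ℤ^d)`;
* §5 Pythagoras, global minimality and uniqueness of the minimiser of `⟨∂A,∂A⟩` over all competitors `A` with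
  `Q'A = B` differing from `H B` by a square-summable field («H_kB is a minimum of ½⟨∂A, ∂A⟩ on the hyperplane
  {A : Q_kA = B, …}», scalar, no `R∂*` constraint in the scalar model);
* §6 the weak Euler–Lagrange equation for `H B` («⟨∂A′, ∂H_kB⟩ = 0 on the subspace {A′ : Q_kA′ = 0, …}») and
  uniqueness of the square-summable weak solution.

HONEST SCOPE.  Scalar (`N = 1`-type) coarse fields on the infinite lattice only; the vector/gauge-field `H_k` with
the axial constraint `R∂*A = 0` of the print is NOT treated here (torus dictionary: `Beta.Ineq167OperatorUpper`).
The `ℓ²` operator bound of §2 is qualitative (its constant grows with the mesh); no mesh-uniform norm is claimed.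
The identity (1.65) is an identity of real numbers for each `B ∈ ℓ²(ℤ^d)`; no statement about `Δ_k` as an
unbounded/bounded operator on other spaces is made.  NOT summit progress: functional analysis of the scalar model.

ABSOLUTE-RULE CENSUS: hypotheses of the theorems below are `0 < a`, `Summable fun x => B x ^ 2` and, in §5–§6,
the competitor's data (`Summable`, block sums, `WeakEL`) only; no `Prop`-valued printed statement, no internally
minted fact.  Citations: [Balaban1984PropagatorsI] p. 29 — text locations; everything else [folklore].
Unit `b2b-balaban-pv23-g10` (SURGE NODE PROVER #23 gen 10, scalar whole-lattice `ℤ^d` column, self-row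
B5-165-HK-L2-ZD); staged byte-identically under `HOME/lean/BalabanYm4/`.
-/

namespace Literature.MathematicalPhysics.QuantumFieldTheory.Balaban1983to89.B5Hk165L2Zd

open Filter Topology
open B6QGQLower276 (X e B blk mem_B lapKer lapKer_symm)
open B4Sect5Proof (latticeConst latticeConst_nonneg)
open B6QGQDecay237 (card_B)
open B5Hk103ScalarZd (Kinv kerH cH deltaH deltaH_pos cH_pos abs_kerH_le summable_expX tsum_expX_le nbhd
  lapKer_eq_zero_of_not_mem tsum_blocks)
open B5Hk103Unique (lapRow BlockMeanZero WeakEL summable_mul_of_sq summable_comp_blk tsum_lapRow_mul_self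
  eq_zero_of_weakEL blockMeanZero_sub weakEL_sub sum_B_kerH weakEL_kerH_col kerH_eq_kerH)
open B5Hk103Minimizer (energy HB summable_sq_sub energy_add lapRow_kerH eq_zero_of_energy_eq_zero)
open B5Hk165ActionZd (actionKer)
open B5Ineq167SymbolZd (kappa actionKer_eq_kappa summable_abs_kappa)
open B5Ineq167SharpUpperZd (gamma1Sharp gamma1Sharp_pos)
open B5Ineq167L2Zd (cutoff cutoff_of_mem cutoff_of_not_mem actionFormZd deltaApply actionFormZd_eq_inner
  ineq167_scalar_l2 actionFormZd_nonneg)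

noncomputable section

variable {d : ℕ}

/-! ## §1  A Schur test for series kernels [folklore] -/

/-- Domination step of the Schur test: for a non-negative summable row `M(p,·)` and `f ∈ ℓ²`, both
`y ↦ M(p,y)f(y)²` and `y ↦ M(p,y)|f(y)|` are summable (`f² ≤ ‖f‖₂²`, `|f| ≤ (1+f²)/2`). [folklore] -/
theorem schur_row_summable {α β : Type*} {M : α → β → ℝ} (hM : ∀ p y, 0 ≤ M p y)
    (hrow : ∀ p, Summable (M p)) {f : β → ℝ} (hf : Summable fun y => f y ^ 2) (p : α) :
    (Summable fun y => M p y * f y ^ 2) ∧ Summable fun y => M p y * |f y| := by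
  have hF : ∀ y, f y ^ 2 ≤ ∑' z, f z ^ 2 := fun y => hf.le_tsum y fun _ _ => sq_nonneg _
  have h1 : Summable fun y => M p y * f y ^ 2 :=
    Summable.of_nonneg_of_le (fun y => mul_nonneg (hM p y) (sq_nonneg _))
      (fun y => by rw [mul_comm]; exact mul_le_mul_of_nonneg_right (hF y) (hM p y))
      ((hrow p).mul_left (∑' z, f z ^ 2))
  refine ⟨h1, Summable.of_nonneg_of_le (fun y => mul_nonneg (hM p y) (abs_nonneg _)) (fun y => ?_)
    (((hrow p).add h1).div_const 2)⟩
  have h0 := hM p y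
  nlinarith [sq_nonneg (|f y| - 1), sq_abs (f y), abs_nonneg (f y)]

/-- **Weighted Cauchy–Schwarz for series**: `(Σ' M|f|)² ≤ (Σ' M)·(Σ' M f²)` for a non-negative summable weight.
[folklore] -/
theorem sq_tsum_mul_abs_le {β : Type*} {M : β → ℝ} (hM : ∀ y, 0 ≤ M y) (hs : Summable M) {f : β → ℝ}
    (h1 : Summable fun y => M y * f y ^ 2) (h2 : Summable fun y => M y * |f y|) :
    (∑' y, M y * |f y|) ^ 2 ≤ (∑' y, M y) * ∑' y, M y * f y ^ 2 := by
  set P := (∑' y, M y) * ∑' y, M y * f y ^ 2 with hP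
  have hP0 : 0 ≤ P :=
    mul_nonneg (tsum_nonneg hM) (tsum_nonneg fun y => mul_nonneg (hM y) (sq_nonneg _))
  have hfin : ∀ s : Finset β, ∑ y ∈ s, M y * |f y| ≤ Real.sqrt P := by
    intro s
    have hcs : (∑ y ∈ s, M y * |f y|) ^ 2 ≤ (∑ y ∈ s, M y) * ∑ y ∈ s, M y * f y ^ 2 := by
      have h := Finset.sum_mul_sq_le_sq_mul_sq s (fun y => Real.sqrt (M y))
        (fun y => Real.sqrt (M y) * |f y|)
      have e1 : ∀ y, Real.sqrt (M y) * (Real.sqrt (M y) * |f y|) = M y * |f y| := fun y => by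
        rw [← mul_assoc, Real.mul_self_sqrt (hM y)]
      have e2 : ∀ y, Real.sqrt (M y) ^ 2 = M y := fun y => Real.sq_sqrt (hM y)
      have e3 : ∀ y, (Real.sqrt (M y) * |f y|) ^ 2 = M y * f y ^ 2 := fun y => by
        rw [mul_pow, Real.sq_sqrt (hM y), sq_abs]
      simpa only [e1, e2, e3] using h
    have hle : (∑ y ∈ s, M y) * ∑ y ∈ s, M y * f y ^ 2 ≤ P :=
      mul_le_mul (hs.sum_le_tsum s fun y _ => hM y)
        (h1.sum_le_tsum s fun y _ => mul_nonneg (hM y) (sq_nonneg _))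
        (Finset.sum_nonneg fun y _ => mul_nonneg (hM y) (sq_nonneg _)) (tsum_nonneg hM)
    have hs0 : 0 ≤ ∑ y ∈ s, M y * |f y| := Finset.sum_nonneg fun y _ => mul_nonneg (hM y) (abs_nonneg _)
    calc ∑ y ∈ s, M y * |f y| = Real.sqrt ((∑ y ∈ s, M y * |f y|) ^ 2) := (Real.sqrt_sq hs0).symm
      _ ≤ Real.sqrt P := Real.sqrt_le_sqrt (hcs.trans hle)
  have hts : ∑' y, M y * |f y| ≤ Real.sqrt P := h2.tsum_le_of_sum_le hfin
  have ht0 : 0 ≤ ∑' y, M y * |f y| := tsum_nonneg fun y => mul_nonneg (hM y) (abs_nonneg _)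
  calc (∑' y, M y * |f y|) ^ 2 ≤ Real.sqrt P ^ 2 := pow_le_pow_left₀ ht0 hts 2
    _ = P := Real.sq_sqrt hP0

/-- **Schur test for series kernels.**  If `M ≥ 0` has summable rows with sums `≤ R` (`R ≥ 0`) and summable
columns with sums `≤ C`, then for every `f ∈ ℓ²`: `p ↦ (Σ'_y M(p,y)|f(y)|)²` is summable and
`Σ'_p (Σ'_y M(p,y)|f(y)|)² ≤ R·C·Σ'_y f(y)²`. [folklore] -/
theorem schur_tsum {α β : Type*} {M : α → β → ℝ} (hM : ∀ p y, 0 ≤ M p y) {R C : ℝ} (hR : 0 ≤ R)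
    (hrow : ∀ p, Summable (M p)) (hrowle : ∀ p, ∑' y, M p y ≤ R)
    (hcol : ∀ y, Summable fun p => M p y) (hcolle : ∀ y, ∑' p, M p y ≤ C)
    {f : β → ℝ} (hf : Summable fun y => f y ^ 2) :
    (Summable fun p => (∑' y, M p y * |f y|) ^ 2) ∧
      ∑' p, (∑' y, M p y * |f y|) ^ 2 ≤ R * C * ∑' y, f y ^ 2 := by
  -- column bookkeeping: `y ↦ (Σ'_p M(p,y))·f(y)²` is summable and its sum is `≤ C‖f‖₂²`
  have hcolS : Summable fun y => (∑' p, M p y) * f y ^ 2 :=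
    Summable.of_nonneg_of_le (fun y => mul_nonneg (tsum_nonneg fun p => hM p y) (sq_nonneg _))
      (fun y => mul_le_mul_of_nonneg_right (hcolle y) (sq_nonneg _)) (hf.mul_left C)
  -- Fubini for the non-negative family `(y, p) ↦ M(p,y)·f(y)²`
  have hG : Summable (Function.uncurry fun y p => M p y * f y ^ 2) := by
    refine (summable_prod_of_nonneg fun yp => mul_nonneg (hM yp.2 yp.1) (sq_nonneg _)).2 ⟨fun y => ?_, ?_⟩
    · exact (hcol y).mul_right (f y ^ 2)
    · refine hcolS.congr fun y => ?_
      show (∑' p, M p y) * f y ^ 2 = ∑' p, M p y * f y ^ 2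
      rw [tsum_mul_right]
  have hG' : Summable fun py : α × β => M py.1 py.2 * f py.2 ^ 2 := by
    simpa [Function.uncurry] using hG.prod_symm
  have hrow2 : ∀ p, Summable fun y => M p y * f y ^ 2 := fun p => hG'.prod_factor p
  have hsum2 : Summable fun p => ∑' y, M p y * f y ^ 2 := hG'.prod
  have hfub : ∑' p, ∑' y, M p y * f y ^ 2 = ∑' y, ∑' p, M p y * f y ^ 2 :=
    (Summable.tsum_comm' (f := fun p y => M p y * f y ^ 2) hG' hrow2
      fun y => (hcol y).mul_right (f y ^ 2)).symm
  have hbound : ∑' p, ∑' y, M p y * f y ^ 2 ≤ C * ∑' y, f y ^ 2 := by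
    rw [hfub]
    calc ∑' y, ∑' p, M p y * f y ^ 2 = ∑' y, (∑' p, M p y) * f y ^ 2 :=
          tsum_congr fun y => tsum_mul_right
      _ ≤ ∑' y, C * f y ^ 2 :=
          Summable.tsum_le_tsum (fun y => mul_le_mul_of_nonneg_right (hcolle y) (sq_nonneg _)) hcolS (hf.mul_left C)
      _ = C * ∑' y, f y ^ 2 := tsum_mul_left
  -- pointwise weighted Cauchy–Schwarz and the row bound
  have hpt : ∀ p, (∑' y, M p y * |f y|) ^ 2 ≤ R * ∑' y, M p y * f y ^ 2 := fun p =>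
    (sq_tsum_mul_abs_le (hM p) (hrow p) (hrow2 p) (schur_row_summable hM hrow hf p).2).trans
      (mul_le_mul_of_nonneg_right (hrowle p) (tsum_nonneg fun y => mul_nonneg (hM p y) (sq_nonneg _)))
  have hS : Summable fun p => (∑' y, M p y * |f y|) ^ 2 :=
    Summable.of_nonneg_of_le (fun p => sq_nonneg _) hpt (hsum2.mul_left R)
  refine ⟨hS, ?_⟩
  calc ∑' p, (∑' y, M p y * |f y|) ^ 2 ≤ ∑' p, R * ∑' y, M p y * f y ^ 2 :=
        Summable.tsum_le_tsum hpt hS (hsum2.mul_left R)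
    _ = R * ∑' p, ∑' y, M p y * f y ^ 2 := tsum_mul_left
    _ ≤ R * (C * ∑' y, f y ^ 2) := mul_le_mul_of_nonneg_left hbound hR
    _ = R * C * ∑' y, f y ^ 2 := by ring

/-- Corollary of the Schur test for the actual (signed) kernel: `p ↦ Σ'_y f(y)M(p,y)` is square-summable with
`Σ'_p (Σ'_y f(y)M(p,y))² ≤ R·C·‖f‖₂²`, rows/columns measured through `|M|`. [folklore] -/
theorem schur_tsum_signed {α β : Type*} (M : α → β → ℝ) {R C : ℝ} (hR : 0 ≤ R)
    (hrow : ∀ p, Summable fun y => |M p y|) (hrowle : ∀ p, ∑' y, |M p y| ≤ R)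
    (hcol : ∀ y, Summable fun p => |M p y|) (hcolle : ∀ y, ∑' p, |M p y| ≤ C)
    {f : β → ℝ} (hf : Summable fun y => f y ^ 2) :
    (∀ p, Summable fun y => f y * M p y) ∧ (Summable fun p => (∑' y, f y * M p y) ^ 2) ∧
      ∑' p, (∑' y, f y * M p y) ^ 2 ≤ R * C * ∑' y, f y ^ 2 := by
  have hM : ∀ p y, 0 ≤ |M p y| := fun p y => abs_nonneg _
  have hrs : ∀ p, Summable fun y => |M p y| * |f y| := fun p => (schur_row_summable hM hrow hf p).2
  have hrow' : ∀ p, Summable fun y => f y * M p y := fun p =>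
    (hrs p).of_norm_bounded fun y => by rw [Real.norm_eq_abs, abs_mul, mul_comm]
  obtain ⟨hS, hle⟩ := schur_tsum hM hR hrow hrowle hcol hcolle hf
  have hpt : ∀ p, (∑' y, f y * M p y) ^ 2 ≤ (∑' y, |M p y| * |f y|) ^ 2 := fun p => by
    have h1 : |∑' y, f y * M p y| ≤ ∑' y, |M p y| * |f y| := by
      have h := norm_tsum_le_tsum_norm ((hrs p).congr fun y => by
        rw [Real.norm_eq_abs, abs_mul, mul_comm] : Summable fun y => ‖f y * M p y‖)
      rw [Real.norm_eq_abs] at h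
      refine h.trans_eq (tsum_congr fun y => ?_)
      rw [Real.norm_eq_abs, abs_mul, mul_comm]
    calc (∑' y, f y * M p y) ^ 2 = |∑' y, f y * M p y| ^ 2 := (sq_abs _).symm
      _ ≤ (∑' y, |M p y| * |f y|) ^ 2 := pow_le_pow_left₀ (abs_nonneg _) h1 2
  have hS' : Summable fun p => (∑' y, f y * M p y) ^ 2 :=
    Summable.of_nonneg_of_le (fun p => sq_nonneg _) hpt hS
  exact ⟨hrow', hS', (Summable.tsum_le_tsum hpt hS' hS).trans hle⟩

/-! ## §2  `H` on square-summable coarse data [print-located: «Q_kH_kB = B», «well-defined bounded operators»] -/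

/-- `(H B)(p) = Σ'_{y∈ℤ^d} B(y)·H(p,y)` — the scalar operator `H = G'Q'*(Q'G'Q'*)⁻¹` of (1.103) applied to an
ARBITRARY coarse field on `ℤ^d` (absolutely convergent for `B ∈ ℓ²`, `summable_HBZd_row`).
[cite: Balaban1984PropagatorsI, (1.103) p.34; p.29] -/
def HBZd (n : ℕ) (a : ℝ) (Bf : X d → ℝ) (p : X d) : ℝ := ∑' y : X d, Bf y * kerH n a p y

/-- Row sums of `|H(p,·)|`: summable, `Σ'_y |H(p,y)| ≤ c_H·(n+1)^{d/2}·K_d(δ_H)`. [folklore] -/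
theorem abs_kerH_row (n : ℕ) {a : ℝ} (ha : 0 < a) (p : X d) :
    (Summable fun y : X d => |kerH n a p y|) ∧
      ∑' y : X d, |kerH n a p y| ≤ cH d a * Real.sqrt (((n : ℝ) + 1) ^ d) * latticeConst d (deltaH d a) := by
  set c : ℝ := cH d a * Real.sqrt (((n : ℝ) + 1) ^ d) with hc
  have hc0 : 0 ≤ c := mul_nonneg (cH_pos d ha).le (Real.sqrt_nonneg _)
  have hmaj : Summable fun y : X d => c * Real.exp (-(deltaH d a * dist (blk n p) y)) :=
    (summable_expX (deltaH_pos d ha) (blk n p)).mul_left c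
  have hS : Summable fun y : X d => |kerH n a p y| :=
    Summable.of_nonneg_of_le (fun y => abs_nonneg _) (fun y => abs_kerH_le n ha p y) hmaj
  refine ⟨hS, ?_⟩
  calc ∑' y : X d, |kerH n a p y| ≤ ∑' y : X d, c * Real.exp (-(deltaH d a * dist (blk n p) y)) :=
        Summable.tsum_le_tsum (fun y => abs_kerH_le n ha p y) hS hmaj
    _ = c * ∑' y : X d, Real.exp (-(deltaH d a * dist (blk n p) y)) := tsum_mul_left
    _ ≤ c * latticeConst d (deltaH d a) :=
        mul_le_mul_of_nonneg_left (tsum_expX_le (deltaH_pos d ha) (blk n p)) hc0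

/-- Column sums of `|H(·,y)|` over the fine lattice: summable,
`Σ'_p |H(p,y)| ≤ c_H·(n+1)^{d/2}·((n+1)^d·K_d(δ_H))` (each block contributes `(n+1)^d` equal majorants).
[folklore] -/
theorem abs_kerH_col (n : ℕ) {a : ℝ} (ha : 0 < a) (y : X d) :
    (Summable fun p : X d => |kerH n a p y|) ∧
      ∑' p : X d, |kerH n a p y| ≤
        cH d a * Real.sqrt (((n : ℝ) + 1) ^ d) * (((n : ℝ) + 1) ^ d * latticeConst d (deltaH d a)) := by
  set c : ℝ := cH d a * Real.sqrt (((n : ℝ) + 1) ^ d) with hc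
  have hc0 : 0 ≤ c := mul_nonneg (cH_pos d ha).le (Real.sqrt_nonneg _)
  set G : X d → ℝ := fun y'' => Real.exp (-(deltaH d a * dist y y'')) with hG
  have hGs : Summable G := summable_expX (deltaH_pos d ha) y
  have hG0 : ∀ y'', 0 ≤ G y'' := fun _ => (Real.exp_pos _).le
  have hGb : Summable fun p : X d => G (blk n p) := summable_comp_blk n hGs hG0
  have hmajle : ∀ p : X d, |kerH n a p y| ≤ c * G (blk n p) := fun p => by
    have h := abs_kerH_le n ha p y
    rwa [dist_comm] at h
  have hmaj : Summable fun p : X d => c * G (blk n p) := hGb.mul_left c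
  have hS : Summable fun p : X d => |kerH n a p y| :=
    Summable.of_nonneg_of_le (fun p => abs_nonneg _) hmajle hmaj
  refine ⟨hS, ?_⟩
  have hblk : ∑' p : X d, G (blk n p) = ((n : ℝ) + 1) ^ d * ∑' y'' : X d, G y'' := by
    rw [← tsum_blocks n hGb, ← tsum_mul_left]
    refine tsum_congr fun y'' => ?_
    rw [Finset.sum_congr rfl fun q hq => by rw [mem_B.1 hq], Finset.sum_const, nsmul_eq_mul, card_B]
  calc ∑' p : X d, |kerH n a p y| ≤ ∑' p : X d, c * G (blk n p) := Summable.tsum_le_tsum hmajle hS hmaj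
    _ = c * (((n : ℝ) + 1) ^ d * ∑' y'' : X d, G y'') := by rw [tsum_mul_left, hblk]
    _ ≤ c * (((n : ℝ) + 1) ^ d * latticeConst d (deltaH d a)) :=
        mul_le_mul_of_nonneg_left (mul_le_mul_of_nonneg_left (tsum_expX_le (deltaH_pos d ha) y)
          (by positivity)) hc0

/-- **`H` is a bounded operator `ℓ²(ℤ^d) → ℓ²(ℤ^d_fine)`** (scalar; «well-defined bounded operators»): for
`B ∈ ℓ²(ℤ^d)` every row series of `H B` converges absolutely, `H B` is square-summable, and
`Σ'_p (H B)(p)² ≤ c_H²(n+1)^{2d}K_d(δ_H)²·Σ'_y B(y)²` (mesh-dependent constant; Schur test).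
[cite: Balaban1984PropagatorsI, p.29] -/
theorem HBZd_l2 (n : ℕ) {a : ℝ} (ha : 0 < a) {Bf : X d → ℝ} (hB : Summable fun x => Bf x ^ 2) :
    (∀ p, Summable fun y : X d => Bf y * kerH n a p y) ∧ (Summable fun p => HBZd n a Bf p ^ 2) ∧
      ∑' p, HBZd n a Bf p ^ 2 ≤
        (cH d a * Real.sqrt (((n : ℝ) + 1) ^ d) * latticeConst d (deltaH d a)) *
          (cH d a * Real.sqrt (((n : ℝ) + 1) ^ d) * (((n : ℝ) + 1) ^ d * latticeConst d (deltaH d a))) *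
          ∑' y, Bf y ^ 2 :=
  schur_tsum_signed (fun p y => kerH n a p y)
    ((tsum_nonneg fun _ => abs_nonneg _).trans (abs_kerH_row n ha (0 : X d)).2)
    (fun p => (abs_kerH_row n ha p).1) (fun p => (abs_kerH_row n ha p).2)
    (fun y => (abs_kerH_col n ha y).1) (fun y => (abs_kerH_col n ha y).2) hB

/-- Every row series `Σ'_y B(y)H(p,y)` of `H B` converges absolutely (`B ∈ ℓ²`). [folklore] -/
theorem summable_HBZd_row (n : ℕ) {a : ℝ} (ha : 0 < a) {Bf : X d → ℝ} (hB : Summable fun x => Bf x ^ 2)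
    (p : X d) : Summable fun y : X d => Bf y * kerH n a p y :=
  (HBZd_l2 n ha hB).1 p

/-- `H B ∈ ℓ²` on the fine lattice for `B ∈ ℓ²(ℤ^d)`. [cite: Balaban1984PropagatorsI, p.29] -/
theorem summable_HBZd_sq (n : ℕ) {a : ℝ} (ha : 0 < a) {Bf : X d → ℝ} (hB : Summable fun x => Bf x ^ 2) :
    Summable fun p => HBZd n a Bf p ^ 2 :=
  (HBZd_l2 n ha hB).2.1

/-- On a coarse field vanishing off a finite set `T`, `H B` is the tree's finitely supported `HB n a T B`.
[folklore] -/
theorem HBZd_eq_HB (n : ℕ) (a : ℝ) (T : Finset (X d)) (Bf : X d → ℝ) (hT : ∀ y ∉ T, Bf y = 0) :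
    HBZd n a Bf = HB n a T Bf := by
  funext p
  simp only [HBZd, HB]
  exact tsum_eq_sum fun y hy => by rw [hT y hy, zero_mul]

/-- `H` of a cut-off field is the finitely supported `HB` of the tree. [folklore] -/
theorem HBZd_cutoff (n : ℕ) (a : ℝ) (T : Finset (X d)) (Bf : X d → ℝ) :
    HBZd n a (cutoff T Bf) = HB n a T Bf := by
  rw [HBZd_eq_HB n a T (cutoff T Bf) fun y hy => cutoff_of_not_mem hy]
  funext p
  exact Finset.sum_congr rfl fun y hy => by rw [cutoff_of_mem hy]

/-- `H` does not depend on `a > 0` (inherited from `kerH_eq_kerH`). [folklore] -/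
theorem HBZd_indep (n : ℕ) {a a' : ℝ} (ha : 0 < a) (ha' : 0 < a') (Bf : X d → ℝ) :
    HBZd n a Bf = HBZd n a' Bf := by
  funext p
  simp only [HBZd, kerH_eq_kerH n ha ha']

/-- **Block identity `Q_kH_kB = B` on `ℓ²` data** (scalar, un-normalised `Q'` of the tree):
`Σ_{p∈B(y'')} (H B)(p) = (n+1)^d·B(y'')` for every `B ∈ ℓ²(ℤ^d)`. [cite: Balaban1984PropagatorsI, p.29] -/
theorem sum_B_HBZd (n : ℕ) {a : ℝ} (ha : 0 < a) {Bf : X d → ℝ} (hB : Summable fun x => Bf x ^ 2) (y'' : X d) :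
    ∑ p ∈ B n y'', HBZd n a Bf p = ((n : ℝ) + 1) ^ d * Bf y'' := by
  classical
  simp only [HBZd]
  rw [← Summable.tsum_finsetSum fun p _ => summable_HBZd_row n ha hB p]
  have h : ∀ y : X d, ∑ p ∈ B n y'', Bf y * kerH n a p y =
      Bf y * (((n : ℝ) + 1) ^ d * if y'' = y then 1 else 0) := fun y => by
    rw [← Finset.mul_sum, sum_B_kerH n ha]
  rw [tsum_congr h, tsum_eq_single y'' fun y hy => by simp [Ne.symm hy]]
  simp [mul_comm]

/-! ## §3  The scalar action operator `Δ^{scalar} = κ∗` on `ℓ²(ℤ^d)` [folklore] -/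

/-- **`Δ^{scalar}` is bounded on `ℓ²(ℤ^d)`**: for `B ∈ ℓ²`, `Δ^{scalar}B = κ ∗ B` (`deltaApply`) is square-summable
and `Σ'_x (Δ^{scalar}B)(x)² ≤ ‖κ‖₁²·Σ'_y B(y)²` (Young/Schur with `‖κ‖_{ℓ¹} < ∞`). [folklore] -/
theorem deltaApply_l2 (n : ℕ) {a : ℝ} (ha : 0 < a) {Bf : X d → ℝ} (hB : Summable fun x => Bf x ^ 2) :
    (Summable fun x => deltaApply n a Bf x ^ 2) ∧
      ∑' x, deltaApply n a Bf x ^ 2 ≤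
        (∑' z : X d, |kappa n a z|) * (∑' z : X d, |kappa n a z|) * ∑' y, Bf y ^ 2 := by
  have hκ := summable_abs_kappa n ha (d := d)
  have hrow : ∀ x : X d, Summable fun y : X d => |actionKer n a x y| := fun x => by
    simp_rw [actionKer_eq_kappa n ha]
    exact (Equiv.subLeft x).summable_iff.2 hκ
  have hrowle : ∀ x : X d, ∑' y : X d, |actionKer n a x y| ≤ ∑' z : X d, |kappa n a z| := fun x => by
    simp_rw [actionKer_eq_kappa n ha]
    exact ((Equiv.subLeft x).tsum_eq fun z => |kappa n a z|).le
  have hcol : ∀ y : X d, Summable fun x : X d => |actionKer n a x y| := fun y => by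
    simp_rw [actionKer_eq_kappa n ha]
    exact (Equiv.subRight y).summable_iff.2 hκ
  have hcolle : ∀ y : X d, ∑' x : X d, |actionKer n a x y| ≤ ∑' z : X d, |kappa n a z| := fun y => by
    simp_rw [actionKer_eq_kappa n ha]
    exact ((Equiv.subRight y).tsum_eq fun z => |kappa n a z|).le
  obtain ⟨-, hS, hle⟩ := schur_tsum_signed (fun x y => actionKer n a x y) (tsum_nonneg fun _ => abs_nonneg _)
    hrow hrowle hcol hcolle hB
  have hcomm : ∀ x : X d, ∑' y, Bf y * actionKer n a x y = deltaApply n a Bf x := fun x =>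
    tsum_congr fun y => mul_comm _ _
  simp_rw [hcomm] at hS hle
  exact ⟨hS, hle⟩

/-- `Δ^{scalar}B ∈ ℓ²(ℤ^d)` for `B ∈ ℓ²(ℤ^d)`. [folklore] -/
theorem summable_deltaApply_sq (n : ℕ) {a : ℝ} (ha : 0 < a) {Bf : X d → ℝ} (hB : Summable fun x => Bf x ^ 2) :
    Summable fun x => deltaApply n a Bf x ^ 2 :=
  (deltaApply_l2 n ha hB).1

/-! ## §4  `(−Δ^η)(H B) = (n+1)^{-2}(Δ^{scalar}B)∘blk` and (1.65) on `ℓ²` [print-located; proved outright] -/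

/-- **The un-normalised lattice Laplacian of `H B` is block-constant** with value `(n+1)^{-2}(Δ^{scalar}B)(y'')`
on the block of `y''` (`B ∈ ℓ²`; from `lapRow_kerH` by absolutely convergent linearity). [folklore] -/
theorem lapRow_HBZd (n : ℕ) {a : ℝ} (ha : 0 < a) {Bf : X d → ℝ} (hB : Summable fun x => Bf x ^ 2) (p : X d) :
    lapRow (HBZd n a Bf) p = deltaApply n a Bf (blk n p) / ((n : ℝ) + 1) ^ 2 := by
  have hs : ∀ q : X d, Summable fun y => Bf y * kerH n a q y := fun q => summable_HBZd_row n ha hB q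
  have hsμ : ∀ μ : Fin d,
      Summable fun y => Bf y * (2 * kerH n a p y - kerH n a (p + e μ) y - kerH n a (p - e μ) y) := fun μ =>
    ((((hs p).mul_left 2).sub (hs (p + e μ))).sub (hs (p - e μ))).congr fun y => by ring
  have hμ : ∀ μ : Fin d,
      2 * (∑' y, Bf y * kerH n a p y) - (∑' y, Bf y * kerH n a (p + e μ) y) - ∑' y, Bf y * kerH n a (p - e μ) y
        = ∑' y, Bf y * (2 * kerH n a p y - kerH n a (p + e μ) y - kerH n a (p - e μ) y) := fun μ => by
    rw [← tsum_mul_left, ← ((hs p).mul_left 2).tsum_sub (hs (p + e μ)),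
      ← (((hs p).mul_left 2).sub (hs (p + e μ))).tsum_sub (hs (p - e μ))]
    exact tsum_congr fun y => by ring
  have h1 : lapRow (HBZd n a Bf) p = ∑' y, Bf y * lapRow (fun r => kerH n a r y) p := by
    simp only [lapRow, HBZd]
    rw [Finset.sum_congr rfl fun μ _ => hμ μ, ← Summable.tsum_finsetSum fun μ _ => hsμ μ]
    exact tsum_congr fun y => by rw [Finset.mul_sum]
  rw [h1, deltaApply, ← tsum_div_const]
  refine tsum_congr fun y => ?_
  rw [lapRow_kerH n ha, actionKer]
  ring

/-- Block summation of a block-constant factor against `H B`: `Σ'_p G(blk p)(H B)(p) = (n+1)^d Σ'_y G(y)B(y)` for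
`G, B ∈ ℓ²(ℤ^d)`. [folklore] -/
theorem tsum_comp_blk_mul_HBZd (n : ℕ) {a : ℝ} (ha : 0 < a) {Bf G : X d → ℝ} (hB : Summable fun x => Bf x ^ 2)
    (hG : Summable fun x => G x ^ 2) :
    (Summable fun p => G (blk n p) * HBZd n a Bf p) ∧
      ∑' p, G (blk n p) * HBZd n a Bf p = ((n : ℝ) + 1) ^ d * ∑' y, G y * Bf y := by
  have hprod : Summable fun p => G (blk n p) * HBZd n a Bf p :=
    summable_mul_of_sq (summable_comp_blk n hG fun _ => sq_nonneg _) (summable_HBZd_sq n ha hB)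
  refine ⟨hprod, ?_⟩
  rw [← tsum_blocks n hprod, ← tsum_mul_left]
  refine tsum_congr fun y => ?_
  rw [Finset.sum_congr rfl fun q hq => by rw [mem_B.1 hq], ← Finset.mul_sum, sum_B_HBZd n ha hB y]
  ring

/-- **(1.65) on `ℓ²(ℤ^d)`** (scalar, whole lattice): for every square-summable coarse field `B` on `ℤ^d`,
`⟨∂(H B), ∂(H B)⟩ = (n+1)^d/(n+1)² · ⟨B, Δ^{scalar}_{n,a}B⟩_{ℤ^d}`, i.e.
`energy (HBZd n a B) = (n+1)^d/(n+1)² · actionFormZd n a B` — the tree's `energy_HB_eq` without the finite-support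
hypothesis (direct proof: `ℓ²` summation by parts `tsum_lapRow_mul_self`, block summation, `actionFormZd_eq_inner`).
[cite: Balaban1984PropagatorsI, (1.65) p.29] -/
theorem energy_HBZd_eq (n : ℕ) {a : ℝ} (ha : 0 < a) (Bf : X d → ℝ) (hB : Summable fun x => Bf x ^ 2) :
    energy (HBZd n a Bf) = ((n : ℝ) + 1) ^ d / ((n : ℝ) + 1) ^ 2 * actionFormZd n a Bf := by
  have hH2 := summable_HBZd_sq n ha hB
  obtain ⟨-, hblk⟩ := tsum_comp_blk_mul_HBZd n ha hB (summable_deltaApply_sq n ha hB)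
  rw [energy, ← tsum_lapRow_mul_self hH2]
  simp_rw [lapRow_HBZd n ha hB]
  calc ∑' p, deltaApply n a Bf (blk n p) / ((n : ℝ) + 1) ^ 2 * HBZd n a Bf p
      = (∑' p, deltaApply n a Bf (blk n p) * HBZd n a Bf p) / ((n : ℝ) + 1) ^ 2 := by
        rw [← tsum_div_const]
        exact tsum_congr fun p => by ring
    _ = ((n : ℝ) + 1) ^ d / ((n : ℝ) + 1) ^ 2 * actionFormZd n a Bf := by
        rw [hblk, actionFormZd_eq_inner n ha hB, tsum_congr fun y => mul_comm (deltaApply n a Bf y) (Bf y)]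
        ring

/-- **(1.67) in the (1.65) dress, on `ℓ²(ℤ^d)`**: `(n+1)^d/(n+1)²·⟨∂₁B,∂₁B⟩ ≤ ⟨∂HB, ∂HB⟩ ≤
(n+1)^d/(n+1)²·(π²/4)^{d+1}·⟨∂₁B,∂₁B⟩` for every square-summable `B` (combining `energy_HBZd_eq` with node 1's
`ineq167_scalar_l2`). [cite: Balaban1984PropagatorsI, (1.65) & (1.67) p.29] -/
theorem ineq167_energy_HBZd (n : ℕ) {a : ℝ} (ha : 0 < a) (Bf : X d → ℝ) (hB : Summable fun x => Bf x ^ 2) :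
    ((n : ℝ) + 1) ^ d / ((n : ℝ) + 1) ^ 2 * energy Bf ≤ energy (HBZd n a Bf) ∧
      energy (HBZd n a Bf) ≤ ((n : ℝ) + 1) ^ d / ((n : ℝ) + 1) ^ 2 * (gamma1Sharp d * energy Bf) := by
  obtain ⟨h1, h2⟩ := ineq167_scalar_l2 n ha Bf hB
  have hc : 0 ≤ ((n : ℝ) + 1) ^ d / ((n : ℝ) + 1) ^ 2 := by positivity
  rw [energy_HBZd_eq n ha Bf hB]
  exact ⟨mul_le_mul_of_nonneg_left h1 hc, mul_le_mul_of_nonneg_left h2 hc⟩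

/-! ## §5  Pythagoras, minimality and uniqueness on `ℓ²` data [print-located: «H_kB is a minimum of ½⟨∂A, ∂A⟩ …»] -/

/-- Orthogonality `⟨(−Δ^η)(H B), D⟩ = 0` for every square-summable `D` with `Q'D = 0` (`B ∈ ℓ²`): the Laplacian
of `H B` is block-constant. [folklore] -/
theorem tsum_lapRow_HBZd_mul_eq_zero (n : ℕ) {a : ℝ} (ha : 0 < a) {Bf : X d → ℝ}
    (hB : Summable fun x => Bf x ^ 2) {D : X d → ℝ} (hD2 : Summable fun p => D p ^ 2)
    (hQ : BlockMeanZero n D) : ∑' p, lapRow (HBZd n a Bf) p * D p = 0 := by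
  have hprod : Summable fun p => deltaApply n a Bf (blk n p) * D p :=
    summable_mul_of_sq (summable_comp_blk n (summable_deltaApply_sq n ha hB) fun _ => sq_nonneg _) hD2
  have h0 : ∑' p, deltaApply n a Bf (blk n p) * D p = 0 := by
    rw [← tsum_blocks n hprod]
    have hy : ∀ y : X d, ∑ q ∈ B n y, deltaApply n a Bf (blk n q) * D q = 0 := fun y => by
      rw [Finset.sum_congr rfl fun q hq => by rw [mem_B.1 hq], ← Finset.mul_sum, hQ y, mul_zero]
    rw [tsum_congr hy, tsum_zero]
  simp_rw [lapRow_HBZd n ha hB]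
  calc ∑' p, deltaApply n a Bf (blk n p) / ((n : ℝ) + 1) ^ 2 * D p
      = (∑' p, deltaApply n a Bf (blk n p) * D p) / ((n : ℝ) + 1) ^ 2 := by
        rw [← tsum_div_const]
        exact tsum_congr fun p => by ring
    _ = 0 := by rw [h0, zero_div]

/-- **Pythagoras on `ℓ²` data**: if `Q'A = (n+1)^d·B` blockwise (`B ∈ ℓ²(ℤ^d)`) and `A − H B` is square-summable,
then `⟨∂A,∂A⟩ = ⟨∂HB,∂HB⟩ + ⟨∂(A − HB), ∂(A − HB)⟩`. [cite: Balaban1984PropagatorsI, p.29] -/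
theorem energy_eq_add (n : ℕ) {a : ℝ} (ha : 0 < a) {Bf : X d → ℝ} (hB : Summable fun x => Bf x ^ 2)
    (A : X d → ℝ) (hA2 : Summable fun p => (A p - HBZd n a Bf p) ^ 2)
    (hAQ : ∀ y'', ∑ p ∈ B n y'', A p = ((n : ℝ) + 1) ^ d * Bf y'') :
    energy A = energy (HBZd n a Bf) + energy (fun p => A p - HBZd n a Bf p) := by
  have hQD : BlockMeanZero n fun p => A p - HBZd n a Bf p :=
    blockMeanZero_sub (fun y'' => ((n : ℝ) + 1) ^ d * Bf y'') hAQ (sum_B_HBZd n ha hB)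
  have hsplit : A = fun p => HBZd n a Bf p + (A p - HBZd n a Bf p) := by
    funext p; ring
  conv_lhs => rw [hsplit]
  rw [energy_add (summable_HBZd_sq n ha hB) hA2, tsum_lapRow_HBZd_mul_eq_zero n ha hB hA2 hQD, mul_zero,
    add_zero]

/-- **`H B` minimises `⟨∂A,∂A⟩` on the affine class `{A : Q'A = B, A − H B ∈ ℓ²}`** (scalar, whole lattice,
square-summable data). [cite: Balaban1984PropagatorsI, p.29] -/
theorem energy_HBZd_le (n : ℕ) {a : ℝ} (ha : 0 < a) {Bf : X d → ℝ} (hB : Summable fun x => Bf x ^ 2)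
    (A : X d → ℝ) (hA2 : Summable fun p => (A p - HBZd n a Bf p) ^ 2)
    (hAQ : ∀ y'', ∑ p ∈ B n y'', A p = ((n : ℝ) + 1) ^ d * Bf y'') :
    energy (HBZd n a Bf) ≤ energy A := by
  rw [energy_eq_add n ha hB A hA2 hAQ]
  have h0 : 0 ≤ energy fun p => A p - HBZd n a Bf p :=
    Finset.sum_nonneg fun μ _ => tsum_nonneg fun p => sq_nonneg _
  linarith

/-- **Uniqueness of the minimiser**: a competitor of the class with the same energy IS `H B`.
[cite: Balaban1984PropagatorsI, p.29] -/
theorem eq_HBZd_of_energy_eq (n : ℕ) {a : ℝ} (ha : 0 < a) {Bf : X d → ℝ} (hB : Summable fun x => Bf x ^ 2)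
    (A : X d → ℝ) (hA2 : Summable fun p => (A p - HBZd n a Bf p) ^ 2)
    (hAQ : ∀ y'', ∑ p ∈ B n y'', A p = ((n : ℝ) + 1) ^ d * Bf y'') (hE : energy A = energy (HBZd n a Bf)) :
    A = HBZd n a Bf := by
  have hQD : BlockMeanZero n fun p => A p - HBZd n a Bf p :=
    blockMeanZero_sub (fun y'' => ((n : ℝ) + 1) ^ d * Bf y'') hAQ (sum_B_HBZd n ha hB)
  have hE0 : energy (fun p => A p - HBZd n a Bf p) = 0 := by
    have h := energy_eq_add n ha hB A hA2 hAQ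
    linarith
  funext p
  have h := eq_zero_of_energy_eq_zero hA2 hQD hE0 p
  linarith

/-! ## §6  The weak Euler–Lagrange equation on `ℓ²` data [print-located: «⟨∂A′, ∂H_kB⟩ = 0 on the subspace …»] -/

/-- **`H B` satisfies the weak Euler–Lagrange equation** for every `B ∈ ℓ²(ℤ^d)`: `⟨Δ^η A′, H B⟩ = 0` for every
finitely supported test field with `Q'A′ = 0` (from the column identity `weakEL_kerH_col`, exchanging the finite
test sum with the absolutely convergent row series). [cite: Balaban1984PropagatorsI, p.29 after (1.63)] -/
theorem weakEL_HBZd (n : ℕ) {a : ℝ} (ha : 0 < a) {Bf : X d → ℝ} (hB : Summable fun x => Bf x ^ 2) :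
    WeakEL n (HBZd n a Bf) := by
  classical
  intro S A' hS hQ
  set t : X d → ℝ := fun p => ∑ r ∈ S, ((n : ℝ) + 1) ^ 2 * lapKer p r * A' r with ht
  set W : Finset (X d) := S.biUnion fun r => nbhd n r with hW
  have ht0 : ∀ p ∉ W, t p = 0 := by
    intro p hp
    refine Finset.sum_eq_zero fun r hr => ?_
    have hpr : p ∉ nbhd n r := fun h => hp (Finset.mem_biUnion.2 ⟨r, hr, h⟩)
    rw [lapKer_symm, lapKer_eq_zero_of_not_mem hpr, mul_zero, zero_mul]
  have hs : ∀ p, Summable fun y => Bf y * kerH n a p y := summable_HBZd_row n ha hB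
  have hcol : ∀ y : X d, ∑' p, t p * kerH n a p y = 0 := fun y => weakEL_kerH_col n ha y S A' hS hQ
  show ∑' p, t p * HBZd n a Bf p = 0
  rw [tsum_eq_sum fun p (hp : p ∉ W) => by rw [ht0 p hp, zero_mul]]
  simp only [HBZd]
  calc ∑ p ∈ W, t p * ∑' y, Bf y * kerH n a p y
      = ∑ p ∈ W, ∑' y, t p * (Bf y * kerH n a p y) :=
        Finset.sum_congr rfl fun p _ => tsum_mul_left.symm
    _ = ∑' y, ∑ p ∈ W, t p * (Bf y * kerH n a p y) :=
        (Summable.tsum_finsetSum fun p _ => (hs p).mul_left (t p)).symm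
    _ = ∑' y, Bf y * ∑ p ∈ W, t p * kerH n a p y :=
        tsum_congr fun y => by
          rw [Finset.mul_sum]
          exact Finset.sum_congr rfl fun p _ => by ring
    _ = ∑' y, Bf y * ∑' p, t p * kerH n a p y :=
        tsum_congr fun y => by rw [tsum_eq_sum fun p (hp : p ∉ W) => by rw [ht0 p hp, zero_mul]]
    _ = 0 := by simp [hcol]

/-- **Uniqueness of the square-summable weak solution**: a square-summable fine field `K` with block sums
`(n+1)^d·B` satisfying the weak Euler–Lagrange equation IS `H B` (`B ∈ ℓ²(ℤ^d)`; from `eq_zero_of_weakEL`).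
[cite: Balaban1984PropagatorsI, p.29] -/
theorem eq_HBZd_of_weakEL (n : ℕ) {a : ℝ} (ha : 0 < a) {Bf : X d → ℝ} (hB : Summable fun x => Bf x ^ 2)
    (K : X d → ℝ) (hK2 : Summable fun p => K p ^ 2)
    (hKQ : ∀ y'', ∑ p ∈ B n y'', K p = ((n : ℝ) + 1) ^ d * Bf y'') (hKEL : WeakEL n K) :
    K = HBZd n a Bf := by
  funext p
  have h := eq_zero_of_weakEL (summable_sq_sub hK2 (summable_HBZd_sq n ha hB))
    (blockMeanZero_sub (fun y'' => ((n : ℝ) + 1) ^ d * Bf y'') hKQ (sum_B_HBZd n ha hB))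
    (weakEL_sub hKEL (weakEL_HBZd n ha hB)) p
  linarith

/-- **Characterisation of `H B` on `ℓ²` data** (scalar «all the properties of H_kB», whole lattice): for
`B ∈ ℓ²(ℤ^d)` and a square-summable fine field `K`, `K = H B` iff `Q'K = (n+1)^d·B` blockwise and `K` satisfies
the weak Euler–Lagrange equation. [cite: Balaban1984PropagatorsI, p.29] -/
theorem HBZd_iff (n : ℕ) {a : ℝ} (ha : 0 < a) {Bf : X d → ℝ} (hB : Summable fun x => Bf x ^ 2)
    (K : X d → ℝ) (hK2 : Summable fun p => K p ^ 2) :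
    K = HBZd n a Bf ↔
      (∀ y'', ∑ p ∈ B n y'', K p = ((n : ℝ) + 1) ^ d * Bf y'') ∧ WeakEL n K := by
  constructor
  · rintro rfl
    exact ⟨sum_B_HBZd n ha hB, weakEL_HBZd n ha hB⟩
  · rintro ⟨hKQ, hKEL⟩
    exact eq_HBZd_of_weakEL n ha hB K hK2 hKQ hKEL

end

end Literature.MathematicalPhysics.QuantumFieldTheory.Balaban1983to89.B5Hk165L2Zd
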